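import Mathlib
import Summits.NavierStokesRegularity.NavierStokesRegularity.Theorems.LandauTailLandauTailBlowupVitali

/-!
# Vitali's convergence theorem from a uniform `L^q` bound, general exponents

Helper file for crux `LandauTailBlowup` (stmt-NavierStokesRegularity-1944), line `registered`,
registered stub `landauTail_tendsto_eLpNorm_of_eLpNorm_le` (A1, "Vitali from a uniform `L^q`
bound, general exponents"): on a finite measure space over `ℝ × ℝ³`, a sequence `f n` that is
bounded in `L^q` for some `q < ∞` and converges a.e. to `g` converges to `g` in `L^p` for every
`1 ≤ p < q`.

Pure measure theory, no PDE: the family is uniformly integrable in `L^p`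
(`landauTail_unifIntegrable_of_eLpNorm_le`, Hölder on indicators), Fatou
(`MeasureTheory.Lp.eLpNorm_le_of_ae_tendsto`) puts the a.e. limit in `L^q ⊆ L^p`, and Mathlib's
Vitali convergence theorem `MeasureTheory.tendsto_Lp_finite_of_tendsto_ae` concludes.  This is
the `p`-general version of `landauTail_tendsto_eLpNorm_two_of_eLpNorm_le` (the case `p = 2`),
used by the lead at `p = 1` and `p = 5/3 < 2 = q` to pass to the limit in the linear and cross
terms of the very weak Navier–Stokes identity along blow-up rescalings.
-/

set_option linter.dupNamespace false

namespace Summit.NavierStokesRegularity.NavierStokesRegularity.Theorems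

open MeasureTheory Set Filter Topology
open scoped ENNReal NNReal

/-- **Vitali from a uniform `L^q` bound, general exponents** [folklore; Vitali's convergence
theorem] (registered stub A1 of crux `LandauTailBlowup`, stmt-NavierStokesRegularity-1944): on a
finite measure space over `ℝ × ℝ³`, if `1 ≤ p < q < ∞`, each `f n` is a.e.-strongly measurable,
`‖f n‖_{L^q(μ)} ≤ C`, and `f n → g` a.e., then `‖f n - g‖_{L^p(μ)} → 0`.  Proof: the family is
uniformly integrable in `L^p` (`landauTail_unifIntegrable_of_eLpNorm_le`), the limit is in
`L^q ⊆ L^p` by Fatou, and `MeasureTheory.tendsto_Lp_finite_of_tendsto_ae` applies. -/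
theorem landauTail_tendsto_eLpNorm_of_eLpNorm_le : ∀ (μ : MeasureTheory.Measure (ℝ × EuclideanSpace ℝ (Fin 3))) [MeasureTheory.IsFiniteMeasure μ] (f : ℕ → ℝ × EuclideanSpace ℝ (Fin 3) → EuclideanSpace ℝ (Fin 3)) (g : ℝ × EuclideanSpace ℝ (Fin 3) → EuclideanSpace ℝ (Fin 3)) (p q : ENNReal), 1 ≤ p → p < q → q ≠ ⊤ → (∀ n, MeasureTheory.AEStronglyMeasurable (f n) μ) → (∃ C : NNReal, ∀ n, MeasureTheory.eLpNorm (f n) q μ ≤ C) → (∀ᵐ x ∂μ, Filter.Tendsto (fun n => f n x) Filter.atTop (nhds (g x))) → Filter.Tendsto (fun n => MeasureTheory.eLpNorm (f n - g) p μ) Filter.atTop (nhds 0) := by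
  intro μ _ f g p q hp hpq hqtop hf hbound hfg
  obtain ⟨C, hC⟩ := hbound
  have hgq : MemLp g q μ :=
    ⟨aestronglyMeasurable_of_tendsto_ae atTop hf hfg,
      (Lp.eLpNorm_le_of_ae_tendsto (Eventually.of_forall hC) hf hfg).trans_lt ENNReal.coe_lt_top⟩
  have hgp : MemLp g p μ := hgq.mono_exponent hpq.le
  have hui : UnifIntegrable f p μ :=
    landauTail_unifIntegrable_of_eLpNorm_le hp hpq hqtop hf hC
  exact tendsto_Lp_finite_of_tendsto_ae hp hpq.ne_top hf hgp hui hfg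

end Summit.NavierStokesRegularity.NavierStokesRegularity.Theorems
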